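import Literature.Topology.FourManifolds.LatticeFormsSplitting
import HarnessLib

/-!
# Eichler transvections of a bilinear module

Topic `Literature/Topology/FourManifolds`; companion of `LatticeFormsOrthoSum.lean` and
`LatticeFormsSplitting.lean` (integral lattices), written for the proof architecture of Wall's
theorem on diffeomorphisms, Kirby 1989 Ch. X Thm. 2 (the named fact
`Literature.Topology.FourManifolds.exists_diffeomorph_freeCohomologyMap_eq_of_isometryEquiv` of
`WallDiffeomorphisms.lean`): the automorphisms `A_w`, `A'_w` of `Q_N ⊕ H` that Kirby realises by
handle slides (LNM 1374, p. 62) are Eichler transvections, and Wall's generation theorem for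
`O(Q_N ⊕ H)` (J. London Math. Soc. 39 (1964), p. 136; Math. Ann. 147 (1962); J. reine angew.
Math. 213 (1963)) is phrased in terms of them; the specialisation to `Q ⊕ H` with Kirby's printed
formulas, and the isometries of `H`, are in `LatticeFormsWallGenerators.lean`.

* `LinearMap.BilinForm.eichlerTransvection B e a q`: the **Eichler transvection**
  `E(e, a, q) : v ↦ v + B(e,v) a - B(a,v) e - q B(e,v) e` of a bilinear module `(M, B)` over a
  commutative ring, as a linear map (Eichler, *Quadratische Formen und orthogonale Gruppen*
  (1952), §3; Wall 1963 writes `E(e, a)` with `q = ½ B(a,a)`). Over `ℤ` one cannot halve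
  `B(a,a)`, so the half-square `q` is carried as a parameter and the hypothesis `B a a = q + q`
  appears exactly where it is needed.
* Proved: the **defect formula** `B(Ev, Ew) = B(v,w) + B(e,v) B(e,w) (B(a,a) - 2q)` for `B`
  symmetric, `B(e,e) = 0`, `B(e,a) = 0` (`map_eichlerTransvection`), so `E(e,a,q)` is an
  isometry when `B(a,a) = 2q`; the **composition law**
  `E(e,a,q) ∘ E(e,b,q') = E(e, a + b, q + q' + B(a,b))` (`eichlerTransvection_comp`) and
  `E(e,0,0) = 1`, whence the inverse `E(e,-a,q)`; the bundled isometry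
  `IsometryEquiv.eichlerTransvection`; **naturality** `φ (E(e,a,q) v) = E(φ e, φ a, q) (φ v)` for
  an isometry `φ` (`IsometryEquiv.map_eichlerTransvection_apply`), so conjugates of Eichler
  transvections by isometries are Eichler transvections.
* Small API the Mathlib structure `LinearMap.BilinForm.IsometryEquiv` lacks at this pin: the
  isometry `-1` (`IsometryEquiv.neg`), `IsometryEquiv.trans_apply`, `IsometryEquiv.refl_apply`.

Everything is proved; no statement of the tree is touched and no named fact is introduced.

## Sources

* M. Eichler, *Quadratische Formen und orthogonale Gruppen* (Springer 1952), §3; C. T. C. Wall,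
  *On the orthogonal groups of unimodular quadratic forms II*, J. reine angew. Math. 213 (1963)
  122–136 (the transformations `E(e, a)`; neither is held — the identities below are elementary
  and tagged folklore).
* R. C. Kirby, *The topology of 4-manifolds*, LNM 1374 (1989), Ch. X, proof of Thm. 2, p. 62 (the
  `A_w` as transvections). [Kirby1989]

## Mathlib

Mathlib has transvections of a module (`LinearMap.transvection`, `Matrix.transvection`) and
reflections (`Module.reflection`), but no Eichler (orthogonal, Siegel) transvections of a bilinear
module, and for `LinearMap.BilinForm.IsometryEquiv` no `neg`, `trans_apply`, `refl_apply` at this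
pin (`lean search 'eichler|Eichler'`, `'IsometryEquiv.neg'`, `'IsometryEquiv.trans_apply'`). The
declarations below are a deliberate dot-notation extension of the Mathlib namespace
`LinearMap.BilinForm`, as in `LatticeFormsOrthoSum.lean`; no name clashes with Mathlib.
-/

noncomputable section

open Module
open LinearMap (BilinForm)

namespace LinearMap.BilinForm

/-! ### Eichler transvections over a commutative ring -/

section CommRing

variable {R : Type*} [CommRing R] {M N : Type*} [AddCommGroup M] [Module R M] [AddCommGroup N]
  [Module R N] (B : BilinForm R M)

/-- The **Eichler transvection** `E(e, a, q) : v ↦ v + B(e,v) a - B(a,v) e - q B(e,v) e` of the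
bilinear module `(M, B)`, as a linear map, for arbitrary `e a : M`, `q : R`. It is an isometry
when `B` is symmetric, `B(e,e) = 0`, `B(e,a) = 0` and `B(a,a) = 2q`
(`IsometryEquiv.eichlerTransvection`); the classical `E(e,a)` has `q = ½ B(a,a)`. Eichler 1952,
§3; Wall 1963. [folklore] -/
def eichlerTransvection (e a : M) (q : R) : M →ₗ[R] M :=
  LinearMap.id + (B e).smulRight a - (B a).smulRight e - q • (B e).smulRight e

/-- The formula `E(e,a,q) v = v + B(e,v) a - B(a,v) e - (q B(e,v)) e`. [folklore] -/
@[simp]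
theorem eichlerTransvection_apply (e a : M) (q : R) (v : M) :
    B.eichlerTransvection e a q v = v + B e v • a - B a v • e - (q * B e v) • e := by
  simp [eichlerTransvection, smul_smul]

/-- `E(e,a,q)` fixes `e` when `B(e,e) = 0` and `B(a,e) = 0`. [folklore] -/
theorem eichlerTransvection_apply_self {e a : M} (he : B e e = 0) (hae : B a e = 0) (q : R) :
    B.eichlerTransvection e a q e = e := by
  simp [he, hae]

/-- On vectors orthogonal to `e`, `E(e,a,q) v = v - B(a,v) e`. [folklore] -/
theorem eichlerTransvection_apply_of_orthogonal {e v : M} (hev : B e v = 0) (a : M) (q : R) :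
    B.eichlerTransvection e a q v = v - B a v • e := by
  simp [hev]

/-- `E(e, 0, 0)` is the identity. [folklore] -/
theorem eichlerTransvection_zero (e : M) : B.eichlerTransvection e 0 0 = LinearMap.id := by
  ext v
  simp

/-- **Defect formula.** For `B` symmetric, `e` isotropic and `a ⊥ e`:
`B(Ev, Ew) = B(v,w) + B(e,v) B(e,w) (B(a,a) - 2q)`; in particular `E(e,a,q)` preserves `B` iff
`B(a,a) = 2q` on the span of the values `B(e,·)`. [folklore] -/
theorem map_eichlerTransvection (hB : B.IsSymm) {e a : M} (he : B e e = 0) (hea : B e a = 0)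
    (q : R) (v w : M) :
    B (B.eichlerTransvection e a q v) (B.eichlerTransvection e a q w) =
      B v w + B e v * B e w * (B a a - (q + q)) := by
  have hae : B a e = 0 := by rw [hB.eq, hea]
  simp only [eichlerTransvection_apply, map_add, map_sub, map_smul, LinearMap.add_apply,
    LinearMap.sub_apply, LinearMap.smul_apply, smul_eq_mul, he, hea, hae, hB.eq v a, hB.eq v e]
  ring

/-- **Composition law** of Eichler transvections with the same isotropic vector:
`E(e,a,q) ∘ E(e,b,q') = E(e, a + b, q + q' + B(a,b))` (for `e` isotropic, `a, b ⊥ e`). With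
`2q = B(a,a)`, `2q' = B(b,b)` the parameter on the right is `½ B(a+b, a+b)`, i.e.
`E(e,a) E(e,b) = E(e, a+b)`. Eichler 1952, §3. [folklore] -/
theorem eichlerTransvection_comp (hB : B.IsSymm) {e a b : M} (he : B e e = 0) (hea : B e a = 0)
    (heb : B e b = 0) (q q' : R) :
    B.eichlerTransvection e a q ∘ₗ B.eichlerTransvection e b q' =
      B.eichlerTransvection e (a + b) (q + q' + B a b) := by
  have hae : B a e = 0 := by rw [hB.eq, hea]
  ext v
  simp only [LinearMap.comp_apply, eichlerTransvection_apply, map_add, map_sub, map_smul,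
    LinearMap.add_apply, he, hae, heb]
  module

/-- `E(e,-a,q)` is a left inverse of `E(e,a,q)` when `B(a,a) = 2q`. [folklore] -/
theorem eichlerTransvection_neg_comp (hB : B.IsSymm) {e a : M} (he : B e e = 0) (hea : B e a = 0)
    {q : R} (hq : B a a = q + q) :
    B.eichlerTransvection e (-a) q ∘ₗ B.eichlerTransvection e a q = LinearMap.id := by
  rw [eichlerTransvection_comp B hB he (by rw [map_neg, hea, neg_zero]) hea, neg_add_cancel,
    ← eichlerTransvection_zero B e]
  congr 1
  rw [map_neg, LinearMap.neg_apply, hq]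
  ring

/-- `E(e,-a,q)` is a right inverse of `E(e,a,q)` when `B(a,a) = 2q`. [folklore] -/
theorem eichlerTransvection_comp_neg (hB : B.IsSymm) {e a : M} (he : B e e = 0) (hea : B e a = 0)
    {q : R} (hq : B a a = q + q) :
    B.eichlerTransvection e a q ∘ₗ B.eichlerTransvection e (-a) q = LinearMap.id := by
  have h := eichlerTransvection_neg_comp B hB he (a := -a) (by rw [map_neg, hea, neg_zero])
    (q := q) (by simpa using hq)
  rwa [neg_neg] at h

/-- The **Eichler transvection as an isometry** `E(e,a,q) : (M, B) ≅ (M, B)` for `B` symmetric,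
`B(e,e) = 0`, `B(e,a) = 0`, `B(a,a) = 2q`, with inverse `E(e,-a,q)`. Eichler 1952, §3; Wall
1963 (`E(e,a)`). [folklore] -/
def IsometryEquiv.eichlerTransvection (hB : B.IsSymm) (e a : M) (q : R) (he : B e e = 0)
    (hea : B e a = 0) (hq : B a a = q + q) : B.IsometryEquiv B :=
  { (LinearEquiv.ofLinear (B.eichlerTransvection e a q) (B.eichlerTransvection e (-a) q)
      (eichlerTransvection_comp_neg B hB he hea hq) (eichlerTransvection_neg_comp B hB he hea hq) :
      M ≃ₗ[R] M) with
    map_app' := fun v w => by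
      change B (B.eichlerTransvection e a q v) (B.eichlerTransvection e a q w) = B v w
      rw [map_eichlerTransvection B hB he hea, hq, sub_self, mul_zero, add_zero] }

/-- The isometry `E(e,a,q)` acts by the transvection formula. [folklore] -/
@[simp]
theorem IsometryEquiv.eichlerTransvection_apply (hB : B.IsSymm) (e a : M) (q : R) (he : B e e = 0)
    (hea : B e a = 0) (hq : B a a = q + q) (v : M) :
    IsometryEquiv.eichlerTransvection B hB e a q he hea hq v = B.eichlerTransvection e a q v :=
  rfl

/-- The inverse of the isometry `E(e,a,q)` is `E(e,-a,q)`. [folklore] -/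
@[simp]
theorem IsometryEquiv.eichlerTransvection_symm_apply (hB : B.IsSymm) (e a : M) (q : R)
    (he : B e e = 0) (hea : B e a = 0) (hq : B a a = q + q) (v : M) :
    (IsometryEquiv.eichlerTransvection B hB e a q he hea hq).symm v =
      B.eichlerTransvection e (-a) q v :=
  rfl

variable {B} {C : BilinForm R N}

/-- **Naturality**: an isometry `φ : (M, B) ≅ (N, C)` carries `E(e,a,q)` to `E(φe, φa, q)`:
`φ (E(e,a,q) v) = E(φ e, φ a, q) (φ v)`. (So conjugates of Eichler transvections by isometries
are Eichler transvections; with `φ` the swap of a hyperbolic pair `x, y` this turns Kirby's `A_w`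
into `A'_w`.) [folklore] -/
theorem IsometryEquiv.map_eichlerTransvection_apply (φ : B.IsometryEquiv C) (e a : M) (q : R)
    (v : M) :
    φ (B.eichlerTransvection e a q v) = C.eichlerTransvection (φ e) (φ a) q (φ v) := by
  simp only [LinearMap.BilinForm.eichlerTransvection_apply, map_add, map_sub,
    LinearMapClass.map_smul, φ.map_app]

/-- **Negation is an isometry** of any bilinear module: `B(-v,-w) = B(v,w)`. [folklore] -/
def IsometryEquiv.neg (B : BilinForm R M) : B.IsometryEquiv B :=
  { LinearEquiv.neg R (M := M) with
    map_app' := fun v w => by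
      change B (-v) (-w) = B v w
      simp }

/-- `IsometryEquiv.neg` acts as `v ↦ -v`. [folklore] -/
@[simp]
theorem IsometryEquiv.neg_apply (B : BilinForm R M) (v : M) : IsometryEquiv.neg B v = -v := rfl

variable {P : Type*} [AddCommGroup P] [Module R P] {D : BilinForm R P}

/-- A composite of isometries acts as the composite map (`f.trans g = g ∘ f`). [folklore] -/
@[simp]
theorem IsometryEquiv.trans_apply (f : B.IsometryEquiv C) (g : C.IsometryEquiv D) (v : M) :
    f.trans g v = g (f v) := rfl

/-- The identity isometry acts as the identity. [folklore] -/
@[simp]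
theorem IsometryEquiv.refl_apply (v : M) : IsometryEquiv.refl B v = v := rfl

end CommRing

end LinearMap.BilinForm

end
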